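import Summits.BirchSwinnertonDyer.BirchSwinnertonDyer.Theorems.ErratumRoadFiveNonSurjCornerHybridTwinMuAnDeepCore
import Summits.BirchSwinnertonDyer.BirchSwinnertonDyer.Theorems.ErratumRoadFiveEulerHalfNotRamLABIndexGuard
import HarnessLib

/-!
# Route `ErratumRoadFive` (rung K2), crux `NonSurjCorner` (item stmt-BirchSwinnertonDyer-19065), line `Lines/hybrid.lean`:
# THE `Ш_an`-CUT OF THE μ-SLOT — analytic `μ = 0` at the leaf twins (item 19948) is load-bearing ONLY at the DEEP corner pairs
# (`0 < ord_p #Ш(E)_an`), exactly like the Kolyvagin certificates (slot 1, g14's cut); glue #20 and the by-items glue in that shape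
# (cell `bsd-stepL`, seat `bsd-stepL-corner-p1` g18; `--supports stmt-BirchSwinnertonDyer-19065 --as helper`)

WHY THIS FILE. In every hybrid glue since g16 (`X11b.erratumRoadFive_nonSurjCorner_of_kolyZShaAn_of_kolyJMax_of_multiUpper_of_lowerLeafTwinDeep_of_
twinMultDivisibility[_of_casselsTate]`, files `…HybridTwinLowerSupply[ChaKernel]`) the p-part at a corner pair `(E, p)` is assembled from FOUR halves:
(U_E) the Euler half of `E` ⟸ Kolyvagin ∕ Shimura over the Heegner field `K` + the twin's LOWER half (slot 4, `X11aLowerHalf` at the leaf twin `E^{d_K}`);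
(L_E) the converse half of `E`, which is TRIVIAL when `ord_p #Ш(E)_an ≤ 0` and otherwise ⟸ Kolyvagin certificates over `K` (slot 1) + the twin's UPPER
half — and the twin's upper half is the ONLY consumer of Kato's divisibility at the twin (`MultDivisibilityAt`, from Kato 12.4 + §17.13 V′∕VI′∕XI′ made
integral by the analytic `μ = 0` of slot 2 = item 19948, `X11b.multDivisibilityAt_of_katoFacts_of_muAn_contra_of_mazur`). Reading the proof: the binder
`hdiv` (Kato divisibility at EVERY non-surjective X11a leaf twin) is used once, inside the branch `0 < ord_p s`, at the Friedberg–Hoffstein twin model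
`Wd = Cd • E^{(d_K)}` of THAT deep pair. So slot 2 can be cut exactly as slot 1 was (g14): **analytic `μ = 0` is needed only at the leaf twins of the
DEEP corner pairs** — those `(E, p)` with `#Ш(E)_an = s`, `0 < ord_p s`. Census (lane B corner5-p2 CENSUS-G9, `N ≤ 4·10¹⁰`): ONE deep pair at `p = 5`
among 2 430 (`J9t-73o125d-14`, `N = 5 112 322 880`, 5S4, `#Ш_an = 25`), NONE at `p = 7` among 57; at every other corner pair item 19948 is IDLE.
* (§1, file `…HybridTwinMuAnDeepCore`) `X11b.erratumRoadFive_nonSurjCorner_of_kolyZShaAn_of_kolyJMax_of_multiUpper_of_lowerLeafTwinDeep_of_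
  twinMultDivisibilityDeep_of_casselsTate` — `…TwinLowerSupplyChaKernel` §2 with `hdiv` asked ONLY at the Friedberg–Hoffstein twin models of the deep pairs;
* §2 GLUE #20 `nonSurjCorner_of_kolyZShaAn_of_twinMuAnDeep_of_fifteenFacts_of_x11aLowerHalf_of_twoPlusFourNamedInputs_of_carrierLabelsB6_pAnchor` —
  glue #19′ (`…HybridLabelsOnlyX11aByName`) with slot 2 replaced by its `Ш_an`-cut `hμD` (19948's allowable-root clause VERBATIM, asked only at the
  twin models `Wd` of deep corner pairs; `Wd` is displayed with its derived leaf data `ClassX11a Wd p`, `¬ Surj Wd p`, `p ∣ ord_p Δ_min(Wd)`);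
* §3 `twinMuAnDeep_of_twinMuAn` — item 19948 implies the cut text (projection), so r17's slots still close the line through glue #20;
* §4 `nonSurjCornerOfItemsDeep_holds` — the by-items glue of RULING 66 (e) in the DEEP shape: from the seven top-level items
  {`PublishedInputsFive`, `X11aLowerHalf`, `EulerHalfGrossPrintFacts`, `ShimuraParametrizationDataNonempty`, `PastenComponentOrdersInput`,
  `ShimuraCasselsTateLevelInputs`, `ShimuraCarrierLabelsB6FromFive`} the implication ‹KolyZ deep text (r17 slot 1)› → ‹μ deep text (§2's `hμD`)› →
  ‹the fifteen twin facts› → `NonSurjCorner` — an alternative child set for the planner's phase-1b re-split in which BOTH open children are asked only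
  at the deep pairs (shape A, children 19946 ∕ 19948 BY NAME, is `nonSurjCornerOfItems_holds`, file `…NonSurjCornerOfItemsHolds`).

HONEST FRAMING: THREE THEOREMS (no definition, no named fact, no `sorry`); CONDITIONAL on every displayed binder; no stub is proved — one open input
(19948) is shown IDLE off the deep pairs; 19065 NOT closed by this file; nothing about any curve's BSD; BSD is not advanced; T7.
References (locators only): [cite: Kato2004Asterisque, Thm. 12.4, §17.13 (pp. 279–280)] [cite: GreenbergLNM1716, §1 Conj. 1.11 (p. 61)]
[cite: Cha2005, Thm. 21 and Rmk. 25] [cite: Jetchev2008, Thm. 1.1, Cor. 1.5] [cite: PastenShimura2024, Prop. 6.13, Lemma 6.18]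
[cite: GrossLMS1991, §3 Prop. 3.7 (2)] [cite: Mazur1978, Cor. 4.1] [cite: Miller2011LMS, Def. 1.1].
-/

set_option autoImplicit false
set_option linter.dupNamespace false -- `Summit.BirchSwinnertonDyer.BirchSwinnertonDyer` (summit = problem), tree-wide

noncomputable section

open scoped Classical NumberField MatrixGroups ModularForm

/-! ### §2 Glue #20: glue #19′ with the μ-slot cut to the DEEP corner pairs -/

namespace Summit.BirchSwinnertonDyer.BirchSwinnertonDyer.Theorems

open CongruenceSubgroup WeierstrassCurve NumberField IsDedekindDomain Field Rat.HeightOneSpectrum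
  Literature.NumberTheory.EllipticCurves
  Literature.NumberTheory.EllipticCurves.ModularForms
  Literature.NumberTheory.Automorphic
  Literature.NumberTheory.EllipticCurves.Rank1Residual
  Literature.NumberTheory.EllipticCurves.Rank1Residual.Typed
  Literature.NumberTheory.EllipticCurves.Wuthrich2014
  Literature.NumberTheory.EllipticCurves.SteinWuthrich2013
  Literature.NumberTheory.EllipticCurves.Greenberg1999
  Literature.NumberTheory.EllipticCurves.Kato2004
  Literature.NumberTheory.EllipticCurves.BarriosEtAl2025
  Literature.NumberTheory.EllipticCurves.EmertonPollackWeston2006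
  Literature.NumberTheory.EllipticCurves.ShimuraCMFamily
  Literature.NumberTheory.GaloisRepresentations Literature.NumberTheory.GaloisCohomology
  Summit.BirchSwinnertonDyer.Rank1Residual
  Summit.BirchSwinnertonDyer.Rank1Residual.X11b
  Summit.BirchSwinnertonDyer.Rank1Residual.X11b.Three.Koly
  Summit.BirchSwinnertonDyer.BirchSwinnertonDyer.Theses.ErratumRoadFive

/-- **GLUE #20 — glue #19′ with slot 2 (analytic `μ = 0` at the leaf twins, item 19948) CUT TO THE DEEP CORNER PAIRS.** Binders: `hZan` (slot 1,
deep Kolyvagin certificates) → `hμD` (slot 2 cut: 19948's allowable-root clause VERBATIM, asked only at the Friedberg–Hoffstein twin models `Wd` of the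
corner pairs with `0 < ord_p #Ш(E)_an`; `Wd`'s derived leaf data displayed as hypotheses) → `hF3` (fifteen facts) → 19064 → hMax2 → hShim4 → `hLabB6T` →
`NonSurjCorner`. Proof = glue #19′ over §1 (the μ-clause is fed to `X11b.multDivisibilityAt_of_katoFacts_of_muAn_contra_of_mazur` at the deep twin
only). CONDITIONAL on every binder; 19065 NOT closed; nothing booked; T7.
[cite: Kato2004Asterisque, Thm. 12.4, §17.13 (pp. 279–280)] [cite: Mazur1978, Cor. 4.1] [cite: GreenbergLNM1716, §1 Conj. 1.11 (p. 61)]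
[cite: PastenShimura2024, Lemma 6.18] [cite: Jetchev2008, Thm. 1.1 and Cor. 1.5] [cite: Cha2005, Thm. 21 and Rmk. 25] [cite: Miller2011LMS, Def. 1.1] -/
theorem nonSurjCorner_of_kolyZShaAn_of_twinMuAnDeep_of_fifteenFacts_of_x11aLowerHalf_of_twoPlusFourNamedInputs_of_carrierLabelsB6_pAnchor
    (hZan : ∀ (W : WeierstrassCurve ℚ) [W.IsElliptic] [W.IsGloballyMinimal] (p : ℕ) [Fact p.Prime]
      (N : ℕ) [NeZero N] (K : Type) [Field K] [NumberField K]
      (Dt : ModularParametrizationData W N) (β : ℤ) (ι : K →+* ℂ),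
      ClassX11b W p → ¬ Surj W p → (p = 5 ∨ p = 7) → p ∣ padicValInt p W.minimalDiscriminantInt →
      ¬ Ram W p → (∃ s : ℚ, shaAn W = (s : ℂ) ∧ 0 < padicValRat p s) →
      W.conductorNorm ℤ = N → IsImaginaryQuadratic K →
      4 < (NumberField.discr K).natAbs → SatisfiesHeegnerHypothesis N K →
      SatisfiesHeegnerHypothesis p K → (4 * (N : ℤ)) ∣ β ^ 2 - NumberField.discr K → ¬ (p : ℤ) ∣ Dt.c →
      (∃ (d₁ : KolyvaginHeegnerData Dt β ι 1) (y : (W.baseChange K).toAffine.Point),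
        WeierstrassCurve.Affine.Point.map (W' := W) (algebraMap K (ringClassField K ι 1)).toRatAlgHom y =
          d₁.derivedPoint ∧
        ∃ Q : (W.baseChange K).toAffine.Point, ((p ^ (padicValNat p W.tamagawaProduct + 1) : ℕ) : ℤ) • Q = y) →
      ∃ M : ℕ, M ≤ padicValNat p W.tamagawaProduct ∧ CertificateAt Dt β ι p M)
    -- slot 2 CUT (this file): analytic μ = 0 ONLY at the Friedberg–Hoffstein twin models of the DEEP corner pairs
    (hμD : ∀ (W : WeierstrassCurve ℚ) [W.IsElliptic] [W.IsGloballyMinimal] (p : ℕ) [Fact p.Prime],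
      ClassX11b W p → ¬ Surj W p → (p = 5 ∨ p = 7) → p ∣ padicValInt p W.minimalDiscriminantInt →
      ¬ Ram W p → (∃ s : ℚ, shaAn W = (s : ℂ) ∧ 0 < padicValRat p s) →
      ∀ (K : Type) [Field K] [NumberField K] (Wd : WeierstrassCurve ℚ) [Wd.IsElliptic] [Wd.IsGloballyMinimal]
        (Cd : VariableChange ℚ),
        IsImaginaryQuadratic K → SatisfiesHeegnerHypothesis (W.conductorNorm ℤ) K →
        (W.quadraticTwist (NumberField.discr K : ℚ)).entireLFunction 1 ≠ 0 →
        Cd • W.quadraticTwist (NumberField.discr K : ℚ) = Wd →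
        ClassX11a Wd p → ¬ Surj Wd p → p ∣ padicValInt p Wd.minimalDiscriminantInt →
        ∀ {N : ℕ} [NeZero N] (f : CuspForm (Gamma0 N) 2), IsNewformOf Wd f →
        ∀ (ϖ : ℚ), (ϖ : ℝ) * Wd.realPeriodRat = plusPeriod f →
        ∀ (a : ℚ_[p]) (L : PowerSeries ℚ_[p]),
          (Wd.HasSplitMultiplicativeReductionAtPrime p → a = 1) →
          (¬ Wd.HasSplitMultiplicativeReductionAtPrime p → a = -1) →
          IsMultPAdicLFunctionOf f p a L →
          ∃ n : ℕ, ‖PowerSeries.coeff n (PowerSeries.C ((ϖ : ℚ) : ℚ_[p]) * L)‖ = 1)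
    -- slot 3 (r14): FIFTEEN named facts
    (hF3 :
      (∀ (N : ℕ) [NeZero N] (W : WeierstrassCurve ℚ) (K : Type) [Field K] [NumberField K], Literature.NumberTheory.EllipticCurves.gross_zagier N W K) ∧
      (∀ (N : ℕ) [NeZero N] (W : WeierstrassCurve ℚ) (K : Type) [Field K] [NumberField K], Literature.NumberTheory.EllipticCurves.kolyvagin N W K) ∧
      Literature.NumberTheory.EllipticCurves.Wuthrich2014.sha_dvd_analyticSha ∧
      Literature.NumberTheory.EllipticCurves.rank_eq_analyticRank_of_analyticRank_le_one ∧
      Literature.NumberTheory.EllipticCurves.ModularForms.exists_isNewformOf ∧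
      Literature.NumberTheory.EllipticCurves.friedbergHoffstein_exists_heegnerField_split_twist_ne_zero ∧
      Literature.NumberTheory.EllipticCurves.ModularForms.mazur_not_dvd_maninConstant_of_odd ∧
      Literature.NumberTheory.EllipticCurves.SteinWuthrich2013.thm61_splitMultiplicative ∧
      Literature.NumberTheory.EllipticCurves.SteinWuthrich2013.thm61_nonsplitMultiplicative ∧
      (∀ (W : WeierstrassCurve ℚ) [W.IsElliptic] [W.IsGloballyMinimal] (p : ℕ) [Fact p.Prime], Literature.NumberTheory.EllipticCurves.greenberg_stevens (W := W) (p := p)) ∧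
      Literature.NumberTheory.EllipticCurves.Cha2005.rmk25_pow_dvd_card_sha_primary_of_certificate ∧
      Literature.NumberTheory.EllipticCurves.Kato2004.thm12_4 ∧
      Literature.NumberTheory.EllipticCurves.Kato2004.exists_multDivisibilityInputs_nonsplit_contra ∧
      Literature.NumberTheory.EllipticCurves.Kato2004.exists_multDivisibilityInputs_split_contra ∧
      Literature.NumberTheory.EllipticCurves.Kato2004.exists_multDivisibilityInputs_fine_contra)
    -- slot 4 (by-items): the crux `X11aLowerHalf` (item 19064) BY NAME
    (h₃ : Summit.BirchSwinnertonDyer.BirchSwinnertonDyer.Theses.ErratumRoadFive.X11aLowerHalf)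
    -- slot 5, conjunct 1 (r16): TWO names
    (hMax2 : GrossLMS1991.prop37_2_frobeniusCongruence ∧ Gross1991_heegnerPoint_sub_ratTorsion_mem_E0_imageFree)
    -- slot 5, conjunct 2 (r17): FOUR Shimura names
    (hShim4 : friedbergHoffstein_exists_twist_ne_zero_inertAt ∧ nonempty_shimuraParametrizationData ∧
      PastenShimura2024_componentOrders ∧
      (∀ (K : Type) [Field K] [NumberField K], casselsTate_levelInputs K))
    -- slot 6 (r10): the labelled CM family at the corner's inert frames with `d_K < −4`, WITH (B6) ONLY AT THE CARRIER PRIMES outside `S`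
    (hLabB6T : ∀ (W : WeierstrassCurve ℚ) [W.IsElliptic] [W.IsGloballyMinimal] (p : ℕ) [Fact p.Prime],
      ClassX11b W p → ¬ Surj W p → (p = 5 ∨ p = 7) →
      ∀ (N : ℕ) [NeZero N] (K : Type) [Field K] [NumberField K] (S : Finset ℕ) (Dt : ModularParametrizationData W N)
        (X : ShimuraCurveData (∏ q ∈ S, q) (N / ∏ q ∈ S, q)) (W' : WeierstrassCurve ℚ) [W'.IsElliptic]
        (P₀ : ShimuraParametrizationData X W'),
        W.conductorNorm ℤ = N → IsImaginaryQuadratic K → NumberField.discr K < -4 → Even S.card →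
        (∀ ℓ ∈ S, ℓ.Prime ∧ ℓ ∣ N ∧ ¬ ℓ ^ 2 ∣ N ∧
          ((Ideal.span {(ℓ : ℤ)}).primesOver (𝓞 K)).ncard = 1 ∧ ¬ (ℓ : ℤ) ∣ NumberField.discr K) →
        (∀ ℓ : ℕ, ℓ.Prime → ℓ ∣ N → ℓ ∉ S → ((Ideal.span {(ℓ : ℤ)}).primesOver (𝓞 K)).ncard = 2) →
        p ∈ S → ¬ (p : ℤ) ∣ Dt.c → P₀.IsMinimalFor W →
        ∃ (ι : K →+* ℂ) (y : (W.baseChange K).toAffine.Point) (degy : ℕ)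
          (ys : (m : ℕ) → (W.baseChange (ringClassField K ι m)).toAffine.Point) (ε : ℤ), 0 < degy ∧
          padicValNat p degy = padicValNat p P₀.deg ∧
          LDerivEK W K = 8 * (Real.pi : ℂ) ^ 2 * peterssonProduct (CongruenceSubgroup.Gamma0 N) 2 Dt.f Dt.f /
              ((((Units.torsionOrder K : ℝ) / 2) ^ 2 * √|(NumberField.discr K : ℝ)| : ℝ) : ℂ) *
            ((y.canonicalHeight : ℂ) / (degy : ℂ)) ∧
          (¬ IsOfFinAddOrder y → 0 < (AddSubgroup.zmultiples y).index) ∧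
          ShimuraWalk.LabelsAt W N K ι y ys ε ∧
          ∀ (q : ℕ) [Fact q.Prime], q ∣ N → q ∉ S → p ∣ (W.baseChange ℚ_[q]).localTamagawaNumber ℤ_[q] → LabelB6 ι W N {q} ys) :
    Summit.BirchSwinnertonDyer.BirchSwinnertonDyer.Theses.ErratumRoadFive.NonSurjCorner := by
  obtain ⟨hGZ, hKo, hWu, hGZK, hnf, hFHs, hMaz, hJs, hJn, hGS, hChaL, h12, hns', hsp', hfine'⟩ := hF3
  obtain ⟨h37, hF1⟩ := hMax2
  -- Poitou–Tate duality for the tree's Selmer structures: a THEOREM (Milne I 4.10(b) for the canonical maps, cell bsd-schneider p626891)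
  have hPTs : ∀ (K : Type) [Field K] [NumberField K], poitouTate_selmerStructure_duality_conj K :=
    poitouTate_conj_forall_of_selmerComplement_canonical
      (fun K _ _ n _ ↦ SchneiderFreeAdditiveX3.PoitouTateReduction.selmerComplement_canonical_holds K n)
  obtain ⟨hFH, hJL, hCO, hCT⟩ := hShim4
  -- the seven former slot-3 conjuncts that are THEOREMS of the tree
  have hmod : hasEntireLFunction_rat := hasEntireLFunction_rat_of_exists_isNewformOf hnf
  have hpar : nonempty_modularParametrizationData :=
    nonempty_modularParametrizationData_of_exists_isNewformOf hnf IsNewformOf.exists_maninConstant_ne_zero_holds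
  have hrec : ∀ (N : ℕ) [NeZero N] (W : WeierstrassCurve ℚ) (K : Type) [Field K] [NumberField K],
      heegnerPointOfConductor_one_galoisConj N W K :=
    fun N _ W K _ _ ↦ heegnerPointOfConductor_one_galoisConj_holds N W K
  have hD36 : ∀ (N : ℕ) [NeZero N] (W : WeierstrassCurve ℚ) (K : Type) [Field K] [NumberField K],
      phi_heegnerTau_mem_singularModuliField N W K :=
    fun N _ W K _ _ ↦ phi_heegnerTau_mem_singularModuliField_holds N W K
  have hPT : ∀ (K : Type) [Field K] [NumberField K],
      Literature.NumberTheory.GaloisCohomology.poitouTate_sum_localTatePairing_eq_zero K :=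
    poitouTate_sum_localTatePairing_eq_zero_holds
  have hBR : localTamagawaNumber_quadraticTwist_two_mem_of_goodReduction :=
    BarriosEtAl2025.localTamagawaNumber_quadraticTwist_two_mem_of_goodReduction_holds
  -- slot 4: the leaf-twin lower half from the crux `X11aLowerHalf` BY NAME (a fortiori)
  have h₄ℓ : ∀ (Wd : WeierstrassCurve ℚ) [Wd.IsElliptic] [Wd.IsGloballyMinimal] (p : ℕ) [Fact p.Prime],
      ClassX11a Wd p → ¬ Surj Wd p → (p = 5 ∨ p = 7) → p ∣ padicValInt p Wd.minimalDiscriminantInt →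
      ¬ X11a.ShaAnUnit Wd p → Typed.MissingLowerBoundAt Wd p :=
    lowerLeafTwinDeep_of_x11aLowerHalf h₃
  exact X11b.erratumRoadFive_nonSurjCorner_of_kolyZShaAn_of_kolyJMax_of_multiUpper_of_lowerLeafTwinDeep_of_twinMultDivisibilityDeep_of_casselsTate
    hGZ hKo hWu hGZK hmod hnf hpar hFHs hMaz hrec hD36 hJs hJn hGS hChaL hCT h37 h₄ℓ hZan
    (X11b.Three.Koly.nonSurjCornerKolyJ_max_of_threeNamedFacts h37 hPTs hF1)
    (fun W _ _ p _ hX hns' h57 hv hnr htam hmulti ↦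
      NonSurjCorner.missingUpperBoundAt_of_carrierLabelsB6_of_twinLower_pAnchor hGZK hmod hnf hMaz hBR hJL hCO hPT hPTs hCT hLabB6T W p hX
        hns' h57 htam hmulti (NonSurjCorner.fhTwinLowerSupplyAt_of_lowerLeafTwinDeep hGZK hmod hnf hFH h₄ℓ W p hX hns' h57 hv hnr))
    (fun W _ _ p _ hX hnsW h57 hv hnr hspos K _ _ Wd _ _ Cd hK hHN hLt hWd hXa hnsd hvd ↦
      X11b.multDivisibilityAt_of_katoFacts_of_muAn_contra_of_mazur Kato2004.nonempty_iwasawaH1Data_holds h12 hnf hns' hsp' hfine'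
        hMaz Wd p hXa.2.1 hXa.2.2.1 hXa.2.2.2.1 hnsd
        (fun f hf ϖ hϖ a L hsa hna hL ↦
          hμD W p hX hnsW h57 hv hnr hspos K Wd Cd hK hHN hLt hWd hXa hnsd hvd f hf ϖ hϖ a L hsa hna hL))

/-! ### §3 r17's slot 2 implies the cut (projection) -/

/-- **Item 19948 implies the deep-cut μ text** (the cut is a restriction: fewer twins, more displayed hypotheses). So every registered slot of r17 still
closes the line through glue #20, and registering the cut loses nothing. Nothing asserted about any curve. [cite: GreenbergLNM1716, §1 Conj. 1.11 (p. 61)] -/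
theorem twinMuAnDeep_of_twinMuAn
    (hμ : Summit.BirchSwinnertonDyer.BirchSwinnertonDyer.Theses.ErratumRoadFive.NonSurjCornerTwinMuAn) :
    ∀ (W : WeierstrassCurve ℚ) [W.IsElliptic] [W.IsGloballyMinimal] (p : ℕ) [Fact p.Prime],
      ClassX11b W p → ¬ Surj W p → (p = 5 ∨ p = 7) → p ∣ padicValInt p W.minimalDiscriminantInt →
      ¬ Ram W p → (∃ s : ℚ, shaAn W = (s : ℂ) ∧ 0 < padicValRat p s) →
      ∀ (K : Type) [Field K] [NumberField K] (Wd : WeierstrassCurve ℚ) [Wd.IsElliptic] [Wd.IsGloballyMinimal]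
        (Cd : VariableChange ℚ),
        IsImaginaryQuadratic K → SatisfiesHeegnerHypothesis (W.conductorNorm ℤ) K →
        (W.quadraticTwist (NumberField.discr K : ℚ)).entireLFunction 1 ≠ 0 →
        Cd • W.quadraticTwist (NumberField.discr K : ℚ) = Wd →
        ClassX11a Wd p → ¬ Surj Wd p → p ∣ padicValInt p Wd.minimalDiscriminantInt →
        ∀ {N : ℕ} [NeZero N] (f : CuspForm (Gamma0 N) 2), IsNewformOf Wd f →
        ∀ (ϖ : ℚ), (ϖ : ℝ) * Wd.realPeriodRat = plusPeriod f →
        ∀ (a : ℚ_[p]) (L : PowerSeries ℚ_[p]),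
          (Wd.HasSplitMultiplicativeReductionAtPrime p → a = 1) →
          (¬ Wd.HasSplitMultiplicativeReductionAtPrime p → a = -1) →
          IsMultPAdicLFunctionOf f p a L →
          ∃ n : ℕ, ‖PowerSeries.coeff n (PowerSeries.C ((ϖ : ℚ) : ℚ_[p]) * L)‖ = 1 := by
  intro W _ _ p _ _ _ h57 _ _ _ K _ _ Wd _ _ Cd _ _ _ _ hXa hnsd hvd N _ f hf ϖ hϖ a L hsa hna hL
  exact hμ Wd p hXa hnsd h57 hvd f hf ϖ hϖ a L hsa hna hL

/-! ### §4 The by-items glue of RULING 66 (e) in the DEEP shape (both open children asked only at the deep pairs) -/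

/-- **The phase-1b glue in the DEEP shape, modulo the seven top-level items** (binder order as RULING 66 (e)): from `PublishedInputsFive` (19066),
`X11aLowerHalf` (19064), `EulerHalfGrossPrintFacts` (27981), `ShimuraParametrizationDataNonempty` (19524), `PastenComponentOrdersInput` (19716),
`ShimuraCasselsTateLevelInputs` (20191), `ShimuraCarrierLabelsB6FromFive` (27982), the implication
‹deep Kolyvagin certificates (r17 slot 1 VERBATIM)› → ‹analytic μ = 0 at the twins of the DEEP corner pairs (§2's `hμD` VERBATIM)› →
‹the fifteen twin facts (= `KatoTwinFactsFiveAnContra`)› → `NonSurjCorner`. An alternative child set for the re-split of 19065: {KolyZ-deep, TwinMuAn-deep,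
Kato child}; items 19946 ∕ 19948 imply the two deep texts (p639164's restriction ∕ §3). Proof: glue #20 with INDEX-FREE LAB ⟹ slot 6 via
`EulerHalfLABIndexGuard.carrierLabelsB6AtFive_of_indexFree` at `p ∈ {5,7}` and Friedberg–Hoffstein inert = conjunct 13 of 19066. CONDITIONAL; 19065 NOT
closed by this file; T7. [cite: PastenShimura2024, Lemma 6.18] [cite: Kato2004Asterisque, Thm. 12.4] [cite: Cha2005, Thm. 21 and Rmk. 25] [cite: Miller2011LMS, Def. 1.1] -/
theorem nonSurjCornerOfItemsDeep_holds
    (h₅ : PublishedInputsFive) (h₃ : X11aLowerHalf) (hF2 : EulerHalfGrossPrintFacts)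
    (hJL : ShimuraParametrizationDataNonempty) (hCO : PastenComponentOrdersInput) (hCTi : ShimuraCasselsTateLevelInputs)
    (hLab : ShimuraCarrierLabelsB6FromFive) :
    -- child 1 (deep): refined-Kolyvagin certificates ONLY at the deep frames of the deep corner pairs (r17 slot 1 VERBATIM; ⟸ 19946)
    (∀ (W : WeierstrassCurve ℚ) [W.IsElliptic] [W.IsGloballyMinimal] (p : ℕ) [Fact p.Prime]
      (N : ℕ) [NeZero N] (K : Type) [Field K] [NumberField K]
      (Dt : ModularParametrizationData W N) (β : ℤ) (ι : K →+* ℂ),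
      ClassX11b W p → ¬ Surj W p → (p = 5 ∨ p = 7) → p ∣ padicValInt p W.minimalDiscriminantInt →
      ¬ Ram W p → (∃ s : ℚ, shaAn W = (s : ℂ) ∧ 0 < padicValRat p s) →
      W.conductorNorm ℤ = N → IsImaginaryQuadratic K →
      4 < (NumberField.discr K).natAbs → SatisfiesHeegnerHypothesis N K →
      SatisfiesHeegnerHypothesis p K → (4 * (N : ℤ)) ∣ β ^ 2 - NumberField.discr K → ¬ (p : ℤ) ∣ Dt.c →
      (∃ (d₁ : KolyvaginHeegnerData Dt β ι 1) (y : (W.baseChange K).toAffine.Point),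
        WeierstrassCurve.Affine.Point.map (W' := W) (algebraMap K (ringClassField K ι 1)).toRatAlgHom y =
          d₁.derivedPoint ∧
        ∃ Q : (W.baseChange K).toAffine.Point, ((p ^ (padicValNat p W.tamagawaProduct + 1) : ℕ) : ℤ) • Q = y) →
      ∃ M : ℕ, M ≤ padicValNat p W.tamagawaProduct ∧ CertificateAt Dt β ι p M) →
    -- child 2 (deep): analytic μ = 0 ONLY at the Friedberg–Hoffstein twin models of the deep corner pairs (§2's `hμD` VERBATIM; ⟸ 19948)
    (∀ (W : WeierstrassCurve ℚ) [W.IsElliptic] [W.IsGloballyMinimal] (p : ℕ) [Fact p.Prime],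
      ClassX11b W p → ¬ Surj W p → (p = 5 ∨ p = 7) → p ∣ padicValInt p W.minimalDiscriminantInt →
      ¬ Ram W p → (∃ s : ℚ, shaAn W = (s : ℂ) ∧ 0 < padicValRat p s) →
      ∀ (K : Type) [Field K] [NumberField K] (Wd : WeierstrassCurve ℚ) [Wd.IsElliptic] [Wd.IsGloballyMinimal]
        (Cd : VariableChange ℚ),
        IsImaginaryQuadratic K → SatisfiesHeegnerHypothesis (W.conductorNorm ℤ) K →
        (W.quadraticTwist (NumberField.discr K : ℚ)).entireLFunction 1 ≠ 0 →
        Cd • W.quadraticTwist (NumberField.discr K : ℚ) = Wd →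
        ClassX11a Wd p → ¬ Surj Wd p → p ∣ padicValInt p Wd.minimalDiscriminantInt →
        ∀ {N : ℕ} [NeZero N] (f : CuspForm (Gamma0 N) 2), IsNewformOf Wd f →
        ∀ (ϖ : ℚ), (ϖ : ℝ) * Wd.realPeriodRat = plusPeriod f →
        ∀ (a : ℚ_[p]) (L : PowerSeries ℚ_[p]),
          (Wd.HasSplitMultiplicativeReductionAtPrime p → a = 1) →
          (¬ Wd.HasSplitMultiplicativeReductionAtPrime p → a = -1) →
          IsMultPAdicLFunctionOf f p a L →
          ∃ n : ℕ, ‖PowerSeries.coeff n (PowerSeries.C ((ϖ : ℚ) : ℚ_[p]) * L)‖ = 1) →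
    -- child 3: `KatoTwinFactsFiveAnContra` (the fifteen twin ∕ MAX facts), spelled out until the child is filed
    ((∀ (N : ℕ) [NeZero N] (W : WeierstrassCurve ℚ) (K : Type) [Field K] [NumberField K], Literature.NumberTheory.EllipticCurves.gross_zagier N W K) ∧
      (∀ (N : ℕ) [NeZero N] (W : WeierstrassCurve ℚ) (K : Type) [Field K] [NumberField K], Literature.NumberTheory.EllipticCurves.kolyvagin N W K) ∧
      Literature.NumberTheory.EllipticCurves.Wuthrich2014.sha_dvd_analyticSha ∧
      Literature.NumberTheory.EllipticCurves.rank_eq_analyticRank_of_analyticRank_le_one ∧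
      Literature.NumberTheory.EllipticCurves.ModularForms.exists_isNewformOf ∧
      Literature.NumberTheory.EllipticCurves.friedbergHoffstein_exists_heegnerField_split_twist_ne_zero ∧
      Literature.NumberTheory.EllipticCurves.ModularForms.mazur_not_dvd_maninConstant_of_odd ∧
      Literature.NumberTheory.EllipticCurves.SteinWuthrich2013.thm61_splitMultiplicative ∧
      Literature.NumberTheory.EllipticCurves.SteinWuthrich2013.thm61_nonsplitMultiplicative ∧
      (∀ (W : WeierstrassCurve ℚ) [W.IsElliptic] [W.IsGloballyMinimal] (p : ℕ) [Fact p.Prime], Literature.NumberTheory.EllipticCurves.greenberg_stevens (W := W) (p := p)) ∧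
      Literature.NumberTheory.EllipticCurves.Cha2005.rmk25_pow_dvd_card_sha_primary_of_certificate ∧
      Literature.NumberTheory.EllipticCurves.Kato2004.thm12_4 ∧
      Literature.NumberTheory.EllipticCurves.Kato2004.exists_multDivisibilityInputs_nonsplit_contra ∧
      Literature.NumberTheory.EllipticCurves.Kato2004.exists_multDivisibilityInputs_split_contra ∧
      Literature.NumberTheory.EllipticCurves.Kato2004.exists_multDivisibilityInputs_fine_contra) →
    NonSurjCorner :=
  fun hZan hμD hF ↦
    nonSurjCorner_of_kolyZShaAn_of_twinMuAnDeep_of_fifteenFacts_of_x11aLowerHalf_of_twoPlusFourNamedInputs_of_carrierLabelsB6_pAnchor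
      hZan hμD hF h₃ hF2 ⟨h₅.2.2.2.2.2.2.2.2.2.2.2.2.1, hJL, hCO, hCTi⟩
      (fun W _ _ p _ hX _ h57 ↦
        EulerHalfLABIndexGuard.carrierLabelsB6AtFive_of_indexFree h₅.2.2.2.2.2.2.1 h₅.2.2.2.2.2.1 hLab W p hX
          (by rcases h57 with rfl | rfl <;> norm_num))

end Summit.BirchSwinnertonDyer.BirchSwinnertonDyer.Theorems

end
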